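import Summits.Parity.GeneralizedHardyLittlewood.Theses.LiouvilleShiftedTables
import Summits.Parity.GeneralizedHardyLittlewood.Theorems.TableChowla.Negative.TableChowlaEveryLevelFaces
import Summits.Parity.GeneralizedHardyLittlewood.Theorems.LiouvilleShiftedTablesLargeDilatedTableChowla
import Summits.Parity.GeneralizedHardyLittlewood.Theorems.LiouvilleShiftedTablesDilatedTableChowlaResistance
import Summits.Parity.GeneralizedHardyLittlewood.Theorems.LiouvilleShiftedTablesDilatedTableChowlaFixedResidueBand
import Summits.Parity.GeneralizedHardyLittlewood.Theorems.LiouvilleShiftedTablesTableToDilated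
import Summits.Parity.GeneralizedHardyLittlewood.Theorems.DilatedTableChowla.Negative.DilatedTableChowlaTightness
import Summits.Parity.GeneralizedHardyLittlewood.Theorems.DilatedTableChowla.Negative.DilatedTableChowlaFrontier
import Summits.Parity.GeneralizedHardyLittlewood.Theorems.DilatedTableChowla.Negative.DilatedTableChowlaPretenders

/-!
# STRATEGY-CENSUS companion — crux `DilatedTableChowla` (stmt-Parity-14271), crux-strategist gen 1

Typed objects behind `Cruxes/DilatedTableChowla/STRATEGY-CENSUS.md` (planner-cstrat-stmt-Parity-14271-p1-0,
2026-08-17).  Nothing here concludes the crux; everything is a composition of LANDED theorems or a bare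
`def … : Prop` used as a signature in the census.  No `sorry`.

* §1 FLOORS — what every concluding skeleton `stub₁ → … → DilatedTableChowla` must contain:
  `floor_everyLevel` (fixed-residue `|·|`-level of distribution `θ` for `λ`, EVERY `θ ∈ [7/12,1)`),
  `floor_parityCore` (the dilation-averaged fixed-shift `μ`–`λ` face), `floor_fixedResidueFace`.
* §2 DECOMPOSITION — D1 (lossless, glue landed): `decomp_D1`, `decomp_D1_lossless`, and the leaves' own floors
  `leaf_table_floor`, `leaf_band_floor`; D2 (fixed-`δ` slices): `CruxAtDelta`, `crux_iff_forall_delta`.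
* §3 STRENGTHEN — `strengthen_S1` (uniform binary Chowla along progressions ⟹ crux, landed).
* §4 NEGATION — the load-bearing / tightness / symbol-sensitivity certificates any counterexample must respect.
* §5 ROUTE-LEVEL RE-CUT (not a decomposition of THIS crux; for the human / tenure): the `RowTwistFace` shape.
-/

namespace Summit.Parity.GeneralizedHardyLittlewood.Cruxes.DilatedTableChowla.StrategyCensus

open Summit.Parity.GeneralizedHardyLittlewood.Theses.LiouvilleShiftedTables
open Summit.Parity.GeneralizedHardyLittlewood

/-! ## §1 Floors of every line -/

/-- **F1 (every level).** Any proof of the crux proves fixed-residue, absolute-value level of distribution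
`x^θ` for `λ` with every log-power saving, for EVERY `θ ∈ [7/12, 1)`. -/
theorem floor_everyLevel (h : DilatedTableChowla) {θ : ℝ} (hθ : 7 / 12 ≤ θ) (hθ' : θ < 1) :
    Theorems.TableChowla.Negative.FixedResidueLevel θ :=
  Theorems.TableChowla.Negative.fixedResidueLevel_of_tableChowla
    (Theorems.LargeDilatedTableChowla.dilatedTableChowla_iff_table_and_item.mp h).1 hθ hθ'

/-- **F2 (parity core).** Any proof of the crux proves the dilation-averaged fixed-shift `μ`–`λ` face
`Σ_{a∼A} |Σ_{b ≤ x/A} μ(b) λ(ab+c)| ≤ 2x/(log x)^C` (all moduli `a ≤ x^{5/12}` inside the BV range: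
pure two-point content, the species of the route's terminal atom `MAvg`). -/
theorem floor_parityCore (h : DilatedTableChowla) : Theorems.TableChowla.Negative.MuDilationFace :=
  Theorems.TableChowla.Negative.muDilationFace_of_tableChowla
    (Theorems.LargeDilatedTableChowla.dilatedTableChowla_iff_table_and_item.mp h).1

/-- The `∀δ` fixed-residue face (level `1 − δ`), as used by the Resistance calibration (p101473). -/
theorem floor_fixedResidueFace (h : DilatedTableChowla) : Theorems.TableChowla.Negative.FixedResidueFace :=
  Theorems.DilatedTableChowla.Resistance.fixedResidueFace_of_dilatedTableChowla h

/-! ## §2 Decomposition -/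

/-- **D1** — the lossless split, glue LANDED (item stmt-Parity-14840, `Theorems.tableToDilated_proof`). -/
theorem decomp_D1 : TableChowla → LargeDilatedTableChowla → DilatedTableChowla :=
  Theorems.LargeDilatedTableChowla.dilatedTableChowla_of_table_of_item

/-- D1 is lossless: the crux IS the conjunction of its two leaves (p88402). -/
theorem decomp_D1_lossless : DilatedTableChowla ↔ TableChowla ∧ LargeDilatedTableChowla :=
  Theorems.LargeDilatedTableChowla.dilatedTableChowla_iff_table_and_item

/-- The same glue by its route name (item `TableToDilated`, closed). -/
example : TableToDilated := Theorems.tableToDilated_proof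

/-- Leaf 1 (`TableChowla`, stmt-Parity-14270) keeps the whole every-level floor F1. -/
theorem leaf_table_floor (h : TableChowla) {θ : ℝ} (hθ : 7 / 12 ≤ θ) (hθ' : θ < 1) :
    Theorems.TableChowla.Negative.FixedResidueLevel θ :=
  Theorems.TableChowla.Negative.fixedResidueLevel_of_tableChowla h hθ hθ'

/-- Leaf 2 (`LargeDilatedTableChowla`, stmt-Parity-14839) carries the thin-family fixed-residue band face
(levels `≥ 2/3 − δ/2`, p106064): its type, by name. -/
example := @Theorems.DilatedTableChowla.FixedResidueBand.bandFace_dvd_of_largeDilatedTableChowla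

/-- **D2** — the crux at ONE window parameter `δ` (the `∀δ` quantifier is what sweeps F1 over every level). -/
def CruxAtDelta (δ : ℝ) : Prop :=
  ∀ c : ℤ, c ≠ 0 → ∀ C : ℝ, 0 < C → ∃ x₀ : ℝ, ∀ x : ℝ, x₀ ≤ x → ∀ A : ℝ, x ^ δ ≤ A → A ≤ x ^ (1 / 3 + δ) →
    ∀ u v : ℕ → ℕ, (∑ q ∈ Finset.Icc 1 ⌊x ^ (δ / 2)⌋₊, (q : ℝ) ^ 3 *
      ∑ a ∈ (Finset.Ioc ⌊A⌋₊ ⌊2 * A⌋₊).filter (fun a : ℕ => a ≡ u q [MOD q]),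
        ∑ a' ∈ (Finset.Ioc ⌊A⌋₊ ⌊2 * A⌋₊).filter (fun a' : ℕ => a' ≡ u q [MOD q]),
          (∑ b ∈ (Finset.Icc 1 ⌊x / A⌋₊).filter (fun b : ℕ => b ≡ v q [MOD q]),
            (ArithmeticFunction.liouville (Int.toNat ((a : ℤ) * b + c)) : ℝ) *
              (ArithmeticFunction.liouville (Int.toNat ((a' : ℤ) * b + c)) : ℝ)) ^ 2) ≤
      x ^ 2 / Real.log x ^ C

/-- The crux is exactly the conjunction of its fixed-`δ` slices over `δ ∈ (0, 1/12]` (quantifier swap). -/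
theorem crux_iff_forall_delta : DilatedTableChowla ↔ ∀ δ : ℝ, 0 < δ → δ ≤ 1 / 12 → CruxAtDelta δ := by
  constructor
  · intro h δ hδ hδ' c hc C hC
    exact h c hc δ hδ hδ' C hC
  · intro h c hc δ hδ hδ' C hC
    exact h δ hδ hδ' c hc C hC

/-! ## §3 Strengthen -/

/-- **S1** — uniform binary Chowla along progressions (pointwise in the dilation and the pair) implies the crux
(landed, p101473).  Strictly MORE rigid, and conjecture-grade: the added rigidity removes the only averaging. -/
example := @Theorems.DilatedTableChowla.Resistance.dilatedTableChowla_of_uniformBinaryChowlaAP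

/-- **S1′** — the generic (one-point-data-relative) version, also landed. -/
example := @Theorems.DilatedTableChowla.Resistance.dilatedTableChowla_of_genericUniformBinaryChowlaAP

/-! ## §4 Negation — certificates a counterexample must respect (all landed `Negative/*`) -/

example := @Theorems.DilatedTableChowla.Negative.false_without_shift_ne_zero
example := @Theorems.DilatedTableChowla.Negative.false_without_delta_pos
example := @Theorems.DilatedTableChowla.Negative.false_without_delta_le
example := @Theorems.DilatedTableChowla.Negative.false_without_lower_window
example := @Theorems.DilatedTableChowla.Negative.false_without_upper_window
example := @Theorems.DilatedTableChowla.Negative.false_with_lower_window_halved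
example := @Theorems.DilatedTableChowla.Negative.false_with_dilations_to_delta
example := @Theorems.DilatedTableChowla.Negative.false_with_weight_four
example := @Theorems.DilatedTableChowla.Negative.false_uniform_in_delta
example := @Theorems.DilatedTableChowla.Negative.false_at_delta_half
example := @Theorems.DilatedTableChowla.Negative.not_dilatedTableChowlaFor_periodic
example := @Theorems.DilatedTableChowla.Negative.crux_iff_offDiagonal
example := @Theorems.DilatedTableChowla.Negative.crux_iff_pointwiseOffSparse
example := @Theorems.DilatedTableChowla.Negative.x0_large

/-! ## §5 Route-level re-cut shape (NOT a decomposition of this crux — for the human / tenure planner)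

What the landed glue `SieveToMAvg` consumes of X1 is the bilinear bound `SieveToMAvg.abs_bilinear_le` fed by
`SieveToMAvg.sum_Fstar_rpow_le` (op-norm `≤ F^{1/4}`, Hölder over `q`) for Heath-Brown coefficient pairs, zero
classes only.  After Cauchy–Schwarz over the SHORT side the requirement is a ROW-TWIST face for the long-side
coefficient `β` drawn from a NAMED class `good` — never for all test vectors.  `good := fun _ _ _ => True`
is the operator-norm form (≡ TableChowla, hence ⊇ F1); `good β :↔ β = 1` is Bombieri–Vinogradov for `λ`
(PROVED, `BVLiouville`); `good β :↔ β = μ` is the parity core (F2 species). -/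

/-- Row-twist face at window parameter `δ` for long-side coefficients in the class `good x A β`:
`Σ_{a ∈ (A,2A]} (Σ_{b ≤ x/A} β b · λ(ab+c))² ≤ (Σ_b β b²) · x / (log x)^C`. -/
def RowTwistFace (δ : ℝ) (good : ℝ → ℝ → (ℕ → ℝ) → Prop) : Prop :=
  ∀ c : ℤ, c ≠ 0 → ∀ C : ℝ, 0 < C → ∃ x₀ : ℝ, ∀ x : ℝ, x₀ ≤ x → ∀ A : ℝ, x ^ δ ≤ A → A ≤ x ^ (1 / 3 + δ) →
    ∀ β : ℕ → ℝ, good x A β →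
      (∑ a ∈ Finset.Ioc ⌊A⌋₊ ⌊2 * A⌋₊,
        (∑ b ∈ Finset.Icc 1 ⌊x / A⌋₊, β b * (ArithmeticFunction.liouville (Int.toNat ((a : ℤ) * b + c)) : ℝ)) ^ 2) ≤
      (∑ b ∈ Finset.Icc 1 ⌊x / A⌋₊, β b ^ 2) * x / Real.log x ^ C

/-- The smooth instance (`β ≡ 1`): the species of `BVLiouville` (moduli `a ≤ x^{5/12} < x^{1/2}`). -/
def RowTwistSmooth (δ : ℝ) : Prop := RowTwistFace δ (fun _ _ β => ∀ b, β b = 1)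

/-- The Möbius instance (`β = μ`): the ℓ²-form of the parity core F2. -/
def RowTwistMoebius (δ : ℝ) : Prop :=
  RowTwistFace δ (fun _ _ β => ∀ b, β b = (ArithmeticFunction.moebius b : ℝ))

end Summit.Parity.GeneralizedHardyLittlewood.Cruxes.DilatedTableChowla.StrategyCensus
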